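import Summits.MatrixMultiplication.MatrixMultiplication.Theses.LevelGradedCohnUmans

/-!
# Negative lemmas for the crux `LevelOneGL2Designs` (stmt-MatrixMultiplication-14080), part M:
the MOAT INEQUALITY (uncertainty principle for translation-invariant function spaces)

Refuter-side (cdisprove) route-level lemma, valid for EVERY finite group `G`: if `J ≤ ℂ^G` is
stable under all left translations `f ↦ f(h·)` and `S ⊆ G`, then
`|G| · dim {f ∈ J : supp f ⊆ S} ≤ |S| · dim J` (`card_mul_finrank_inf_SuppFun_le`).
Proof: in `EuclideanSpace ℂ G`, the "leverage" `Σ_i |b_i(h)|²` of an orthonormal basis `b` of `J`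
dominates `Σ_j |v_j(h)|²` for every orthonormal family `v` inside `J` (Bessel), is therefore
independent of the basis and — by invariance — of `h`, and sums to `dim J` over `h`; a subspace of
`J` supported in `S` has `dim = Σ_j ‖v_j‖² = Σ_{h∈S} Σ_j |v_j(h)|² ≤ |S|·(dim J/|G|)`.
(Ideator 3's N2 for the crux; formalised by the cdisprove seat.  Used in
`Cruxes/LevelOneGL2Designs/Disproof.lean` to show that the garbage `{x⁻¹yy'⁻¹z : y ≠ y'}` of an
`F_k`-separated triple misses at least the fraction `|X||Z|/N_k` of `GL_m(𝔽_p)`.)  No positive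
Theses conclusion anywhere.
-/

noncomputable section

open scoped BigOperators ComplexConjugate InnerProductSpace

namespace Summit.MatrixMultiplication.MatrixMultiplication.Theorems.LevelOneGL2Designs.Negative.Moat

variable {G : Type} [Group G] [Fintype G] [DecidableEq G]

/-- `ℂ^G` with its standard Hermitian structure. -/
abbrev Euc (G : Type) [Fintype G] : Type := EuclideanSpace ℂ G

/-- Left translation `(T g v)(x) = v(g⁻¹ x)` as a linear isometry of `ℂ^G`; `T g δ_h = δ_{gh}`. -/
def T (g : G) : Euc G ≃ₗᵢ[ℂ] Euc G :=
  LinearIsometryEquiv.piLpCongrLeft 2 ℂ ℂ (Equiv.mulLeft g)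

/-- `T g δ_h = δ_{gh}`. -/
theorem T_single (g h : G) (a : ℂ) :
    T g (EuclideanSpace.single h a) = EuclideanSpace.single (g * h) a := by
  unfold T EuclideanSpace.single
  rw [LinearIsometryEquiv.piLpCongrLeft_single]
  rfl

omit [DecidableEq G] in
/-- `(T g v)(x) = v(g⁻¹x)`. -/
theorem T_apply (g : G) (v : Euc G) (x : G) : T g v x = v (g⁻¹ * x) := by
  simp [T, LinearIsometryEquiv.piLpCongrLeft_apply, Equiv.piCongrLeft', Equiv.mulLeft_symm_apply]

/-- The "leverage" of a finite orthonormal system at a vector: `Σ_i |⟪b_i, x⟫|²`. -/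
def lev {ι : Type} [Fintype ι] (b : ι → Euc G) (x : Euc G) : ℝ := ∑ i, ‖⟪b i, x⟫_ℂ‖ ^ 2

omit [Group G] [DecidableEq G] in
/-- **Basis independence / Bessel.**  If `b` is an orthonormal basis of `K` (as a family in `ℂ^G`)
and `v` is any finite orthonormal family inside `K`, then `Σ_j |⟪v_j, x⟫|² ≤ Σ_i |⟪b_i, x⟫|²`. -/
theorem lev_le_lev_of_orthonormal (K : Submodule ℂ (Euc G)) {ι : Type} [Fintype ι]
    (b : OrthonormalBasis ι ℂ K) {κ : Type} [Fintype κ] {v : κ → Euc G}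
    (hv : Orthonormal ℂ v) (hvK : ∀ j, v j ∈ K) (x : Euc G) :
    lev v x ≤ lev (fun i => (b i : Euc G)) x := by
  classical
  -- w := Σ_i ⟪b_i, x⟫ b_i ∈ K, the orthogonal projection written in the basis b
  set w : K := ∑ i, ⟪(b i : Euc G), x⟫_ℂ • b i with hw
  -- ⟪k, x⟫ = ⟪k, w⟫ for every k ∈ K
  have hkey : ∀ k : K, ⟪(k : Euc G), x⟫_ℂ = ⟪(k : Euc G), (w : Euc G)⟫_ℂ := by
    intro k
    -- expand k in the basis b
    have hk : (k : Euc G) = ∑ j, ⟪(b j : Euc G), (k : Euc G)⟫_ℂ • (b j : Euc G) := by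
      have := b.sum_repr' k
      -- inner products in K are those of Euc G
      conv_lhs => rw [← this]
      simp [Submodule.coe_inner]
    have hbw : ∀ j, ⟪(b j : Euc G), (w : Euc G)⟫_ℂ = ⟪(b j : Euc G), x⟫_ℂ := by
      intro j
      rw [hw]
      simp only [Submodule.coe_sum, Submodule.coe_smul, inner_sum, inner_smul_right]
      have horth : ∀ i, ⟪(b j : Euc G), (b i : Euc G)⟫_ℂ = if j = i then 1 else 0 := by
        intro i
        rw [← Submodule.coe_inner, orthonormal_iff_ite.mp b.orthonormal]
      simp_rw [horth]
      simp
    rw [hk]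
    simp only [sum_inner, inner_smul_left, hbw]
  -- Bessel for the family v applied to w, and Parseval for w in the basis b
  have hB := hv.sum_inner_products_le (s := Finset.univ) (w : Euc G)
  have hP : ∑ i, ‖⟪(b i : Euc G), (w : Euc G)⟫_ℂ‖ ^ 2 = ‖(w : Euc G)‖ ^ 2 := by
    have := b.sum_sq_norm_inner_right w
    simp only [Submodule.coe_norm] at this
    exact this
  unfold lev
  calc ∑ j, ‖⟪v j, x⟫_ℂ‖ ^ 2 = ∑ j, ‖⟪v j, (w : Euc G)⟫_ℂ‖ ^ 2 := by
        refine Finset.sum_congr rfl fun j _ => ?_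
        rw [hkey ⟨v j, hvK j⟩]
    _ ≤ ‖(w : Euc G)‖ ^ 2 := hB
    _ = ∑ i, ‖⟪(b i : Euc G), (w : Euc G)⟫_ℂ‖ ^ 2 := hP.symm
    _ = ∑ i, ‖⟪(b i : Euc G), x⟫_ℂ‖ ^ 2 := by
        refine Finset.sum_congr rfl fun i _ => ?_
        rw [hkey (b i)]

/-- Functions supported in `S`, as a subspace of `ℂ^G`. -/
def Supp (S : Finset G) : Submodule ℂ (Euc G) where
  carrier := {v | ∀ x, x ∉ S → v x = 0}
  zero_mem' := by intro x _; rfl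
  add_mem' := by
    intro u v hu hv x hx
    simp [hu x hx, hv x hx]
  smul_mem' := by
    intro c v hv x hx
    simp [hv x hx]

omit [Group G] [DecidableEq G] in
/-- Membership in `Supp S`. -/
theorem mem_Supp {S : Finset G} {v : Euc G} : v ∈ Supp S ↔ ∀ x, x ∉ S → v x = 0 := Iff.rfl

omit [Group G] in
/-- `⟪v, δ_h⟫ = conj (v h)`, so `|⟪v, δ_h⟫| = |v h|`. -/
theorem norm_inner_single (v : Euc G) (h : G) :
    ‖⟪v, EuclideanSpace.single h (1 : ℂ)⟫_ℂ‖ = ‖v h‖ := by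
  rw [EuclideanSpace.inner_single_right]
  simp

omit [Group G] in
/-- **Total leverage = dimension**: `Σ_h Σ_i |⟪b_i, δ_h⟫|² = #ι` for an orthonormal family `b`
(each `b_i` has `Σ_h |b_i(h)|² = ‖b_i‖² = 1`). -/
theorem sum_lev_single {ι : Type} [Fintype ι] {b : ι → Euc G} (hb : Orthonormal ℂ b) :
    ∑ h, lev b (EuclideanSpace.single h 1) = Fintype.card ι := by
  unfold lev
  rw [Finset.sum_comm]
  have : ∀ i, ∑ h, ‖⟪b i, EuclideanSpace.single h (1 : ℂ)⟫_ℂ‖ ^ 2 = 1 := by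
    intro i
    simp_rw [norm_inner_single]
    rw [← EuclideanSpace.norm_sq_eq, hb.norm_eq_one i, one_pow]
  simp [this]

omit [Group G] in
/-- **Supported subspaces are paid for by leverage**: if `b` is an orthonormal basis of `K`, then
`dim (K ⊓ Supp S) ≤ Σ_{h ∈ S} Σ_i |⟪b_i, δ_h⟫|²`. -/
theorem finrank_inf_Supp_le_sum_lev (K : Submodule ℂ (Euc G)) {ι : Type} [Fintype ι]
    (b : OrthonormalBasis ι ℂ K) (S : Finset G) :
    (Module.finrank ℂ ↥(K ⊓ Supp S) : ℝ) ≤ ∑ h ∈ S, lev (fun i => (b i : Euc G)) (EuclideanSpace.single h 1) := by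
  classical
  set V := K ⊓ Supp S
  let c := stdOrthonormalBasis ℂ V
  -- the basis of V as an orthonormal family in Euc G, inside K, supported in S
  have hc : Orthonormal ℂ (fun j => ((c j : V) : Euc G)) := by
    have := c.orthonormal
    rw [orthonormal_iff_ite] at this ⊢
    intro i j
    rw [← Submodule.coe_inner]
    exact this i j
  have hcK : ∀ j, ((c j : V) : Euc G) ∈ K := fun j => (c j).2.1
  have hcS : ∀ j, ∀ x, x ∉ S → ((c j : V) : Euc G) x = 0 := fun j => (c j).2.2
  -- dim V = Σ_j ‖c_j‖² = Σ_j Σ_{h ∈ S} |c_j(h)|²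
  have hdim : (Module.finrank ℂ V : ℝ) = ∑ j, ∑ h ∈ S, ‖⟪((c j : V) : Euc G), EuclideanSpace.single h (1 : ℂ)⟫_ℂ‖ ^ 2 := by
    have h1 : ∀ j, ∑ h ∈ S, ‖⟪((c j : V) : Euc G), EuclideanSpace.single h (1 : ℂ)⟫_ℂ‖ ^ 2 = 1 := by
      intro j
      simp_rw [norm_inner_single]
      rw [Finset.sum_subset (f := fun x => ‖((c j : V) : Euc G) x‖ ^ 2) (Finset.subset_univ S)
          (fun h _ hS => by simp [hcS j h hS]),
        ← EuclideanSpace.norm_sq_eq, hc.norm_eq_one j, one_pow]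
    simp [h1]
  rw [hdim, Finset.sum_comm]
  refine Finset.sum_le_sum fun h _ => ?_
  exact lev_le_lev_of_orthonormal K b hc hcK _

/-- **Invariance makes leverage constant**: if `K` is stable under all left translations `T g`, then
`Σ_i |⟪b_i, δ_{gh}⟫|² = Σ_i |⟪b_i, δ_h⟫|²` for an orthonormal basis `b` of `K`. -/
theorem lev_single_mul (K : Submodule ℂ (Euc G)) (hK : ∀ g, ∀ v ∈ K, T g v ∈ K) {ι : Type}
    [Fintype ι] (b : OrthonormalBasis ι ℂ K) (g h : G) :
    lev (fun i => (b i : Euc G)) (EuclideanSpace.single (g * h) 1)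
      = lev (fun i => (b i : Euc G)) (EuclideanSpace.single h 1) := by
  classical
  -- general fact: lev b (T g x) ≤ lev b x, because (T g)⁻¹ b is another orthonormal family in K
  have hle : ∀ (g : G) (x : Euc G), lev (fun i => (b i : Euc G)) (T g x)
      ≤ lev (fun i => (b i : Euc G)) x := by
    intro g x
    have hv : Orthonormal ℂ (fun i => (T g).symm (b i : Euc G)) := by
      have hb : Orthonormal ℂ (fun i => (b i : Euc G)) := by
        have := b.orthonormal
        rw [orthonormal_iff_ite] at this ⊢
        intro i j; rw [← Submodule.coe_inner]; exact this i j
      exact hb.comp_linearIsometryEquiv (T g).symm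
    have hvK : ∀ i, (T g).symm (b i : Euc G) ∈ K := by
      intro i
      have : (T g).symm = T g⁻¹ := by
        unfold T
        rw [LinearIsometryEquiv.piLpCongrLeft_symm]
        congr 1
        ext x; simp
      rw [this]
      exact hK g⁻¹ _ (b i).2
    have h := lev_le_lev_of_orthonormal K b hv hvK x
    -- lev of the pulled-back family at x equals lev b at T g x
    have heq : lev (fun i => (T g).symm (b i : Euc G)) x = lev (fun i => (b i : Euc G)) (T g x) := by
      unfold lev
      refine Finset.sum_congr rfl fun i _ => ?_
      rw [LinearIsometryEquiv.inner_map_eq_flip, LinearIsometryEquiv.symm_symm]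
    rwa [heq] at h
  apply le_antisymm
  · rw [← T_single g h 1]
    exact hle g _
  · have h1 : EuclideanSpace.single h (1 : ℂ) = T g⁻¹ (EuclideanSpace.single (g * h) 1) := by
      rw [T_single]; simp
    rw [h1]
    exact hle g⁻¹ _

/-- **MOAT INEQUALITY (ideator 3's N2, Euclidean form).**  For a left-translation-invariant
subspace `K ≤ ℂ^G` and any `S ⊆ G`: `|G| · dim (K ⊓ Supp S) ≤ |S| · dim K`. -/
theorem card_mul_finrank_inf_Supp_le (K : Submodule ℂ (Euc G)) (hK : ∀ g, ∀ v ∈ K, T g v ∈ K)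
    (S : Finset G) :
    Fintype.card G * Module.finrank ℂ ↥(K ⊓ Supp S) ≤ S.card * Module.finrank ℂ K := by
  classical
  let b := stdOrthonormalBasis ℂ K
  set L : ℝ := lev (fun i => (b i : Euc G)) (EuclideanSpace.single (1 : G) 1) with hL
  have hconst : ∀ h, lev (fun i => (b i : Euc G)) (EuclideanSpace.single h 1) = L := by
    intro h
    have := lev_single_mul K hK b h 1
    rwa [mul_one] at this
  have hb : Orthonormal ℂ (fun i => (b i : Euc G)) := by
    have := b.orthonormal
    rw [orthonormal_iff_ite] at this ⊢
    intro i j; rw [← Submodule.coe_inner]; exact this i j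
  -- |G| L = dim K
  have htot : (Fintype.card G : ℝ) * L = Module.finrank ℂ K := by
    have := sum_lev_single hb
    simp_rw [hconst] at this
    rw [Finset.sum_const, Finset.card_univ, nsmul_eq_mul] at this
    rw [this, Fintype.card_fin]
  -- dim (K ⊓ Supp S) ≤ |S| L
  have hsub : (Module.finrank ℂ ↥(K ⊓ Supp S) : ℝ) ≤ S.card * L := by
    have := finrank_inf_Supp_le_sum_lev K b S
    simp_rw [hconst] at this
    rwa [Finset.sum_const, nsmul_eq_mul] at this
  have : (Fintype.card G : ℝ) * Module.finrank ℂ ↥(K ⊓ Supp S) ≤ S.card * Module.finrank ℂ K := by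
    calc (Fintype.card G : ℝ) * Module.finrank ℂ ↥(K ⊓ Supp S)
        ≤ Fintype.card G * (S.card * L) := by gcongr
      _ = S.card * (Fintype.card G * L) := by ring
      _ = S.card * Module.finrank ℂ K := by rw [htot]
  exact_mod_cast this

/-! ### Transport to plain functions `G → ℂ` -/

/-- Functions `G → ℂ` supported in `S`. -/
def SuppFun (S : Finset G) : Submodule ℂ (G → ℂ) where
  carrier := {f | ∀ x, x ∉ S → f x = 0}
  zero_mem' := by intro x _; rfl
  add_mem' := by
    intro u v hu hv x hx
    simp [hu x hx, hv x hx]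
  smul_mem' := by
    intro c v hv x hx
    simp [hv x hx]

omit [Group G] [Fintype G] [DecidableEq G] in
/-- Membership in `SuppFun S`. -/
theorem mem_SuppFun {S : Finset G} {f : G → ℂ} : f ∈ SuppFun S ↔ ∀ x, x ∉ S → f x = 0 := Iff.rfl

/-- The identification `ℂ^G ≃ EuclideanSpace ℂ G` (as a linear equivalence). -/
def toEuc : (G → ℂ) ≃ₗ[ℂ] Euc G := (WithLp.linearEquiv 2 ℂ (G → ℂ)).symm

omit [Group G] [DecidableEq G] in
/-- `toEuc` is the identity on values. -/
@[simp] theorem toEuc_apply (f : G → ℂ) (x : G) : toEuc f x = f x := rfl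

/-- **MOAT INEQUALITY for left-invariant spaces of functions** (ideator 3's N2): if `J ≤ ℂ^G` is
stable under `f ↦ f(h·)` for every `h`, then `|G| · dim {f ∈ J : supp f ⊆ S} ≤ |S| · dim J`. -/
theorem card_mul_finrank_inf_SuppFun_le (J : Submodule ℂ (G → ℂ))
    (hJ : ∀ f ∈ J, ∀ h : G, (fun x => f (h * x)) ∈ J) (S : Finset G) :
    Fintype.card G * Module.finrank ℂ ↥(J ⊓ SuppFun S) ≤ S.card * Module.finrank ℂ J := by
  classical
  set K : Submodule ℂ (Euc G) := J.map ((toEuc (G := G)).toLinearMap) with hKdef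
  have hK : ∀ g, ∀ v ∈ K, T g v ∈ K := by
    intro g v hv
    rw [hKdef, Submodule.mem_map] at hv ⊢
    obtain ⟨f, hf, rfl⟩ := hv
    refine ⟨fun x => f (g⁻¹ * x), hJ f hf g⁻¹, ?_⟩
    ext x
    rw [T_apply]
    rfl
  have h1 : Module.finrank ℂ K = Module.finrank ℂ J := by
    rw [hKdef]; exact LinearEquiv.finrank_map_eq toEuc J
  have h2 : Module.finrank ℂ ↥(K ⊓ Supp S) = Module.finrank ℂ ↥(J ⊓ SuppFun S) := by
    have : K ⊓ Supp S = (J ⊓ SuppFun S).map ((toEuc (G := G)).toLinearMap) := by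
      rw [hKdef, Submodule.map_inf (toEuc (G := G)).toLinearMap toEuc.injective]
      congr 1
      ext v
      simp only [Submodule.mem_map, mem_Supp, mem_SuppFun]
      constructor
      · intro hv
        refine ⟨toEuc.symm v, fun x hx => ?_, by simp⟩
        exact hv x hx
      · rintro ⟨f, hf, rfl⟩ x hx
        simpa using hf x hx
    rw [this]
    exact LinearEquiv.finrank_map_eq toEuc _
  have h := card_mul_finrank_inf_Supp_le K hK S
  rwa [h1, h2] at h


end Summit.MatrixMultiplication.MatrixMultiplication.Theorems.LevelOneGL2Designs.Negative.Moat

end
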